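import Summits.BirchSwinnertonDyer.Rank1Residual.Additive.X4ExoticThree
import Summits.BirchSwinnertonDyer.BirchSwinnertonDyer.Theorems.CyclotomicUntwistPSKodairaDictionary
import Summits.BirchSwinnertonDyer.Rank1Residual.Additive.SelectorIdentityTameThreeProofs
import Summits.BirchSwinnertonDyer.BirchSwinnertonDyer.Theses.CyclotomicUntwist
import Literature.NumberTheory.EllipticCurves.NonEisensteinPrimeOfSurjective
import HarnessLib

/-!
# The `3`-adic tower is AUTOMATIC on the cyclic rows: `Addv W 3 ∧ Surj W 3 ∧ v₃(Δ_min)` even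
# ⟹ `ρ̄_{E,3ⁿ}` onto for every `n` — K2's stub `stub_upperHalf_nonTower` is VACUOUS (closed by name)

Cell `pub/bsd-wall` (D-0145 line `route-BirchSwinnertonDyer-CyclotomicUntwist`), seat `bsd-line-cycu-p4`
(width seat 4, gen 3). Helper toward the cruxes K2 `PSRankOneUpperHalfAtThree` (stmt-BirchSwinnertonDyer-21581)
and K1 `PSRankOneLowerHalfAtThree` (stmt-BirchSwinnertonDyer-21580). THEOREMS ONLY (no definition, no named
fact, no `sorry`, no instance); BSD is not proved by this file and no crux is.

## The observation

For an elliptic curve `E = W/ℚ` on ANY model, `j − 1728 = c₆² / Δ` (`1728 Δ = c₄³ − c₆²`), so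
`v₃(j − 1728) = 2·v₃(c₆) − v₃(Δ)` has the PARITY of `v₃(Δ)` (or `j = 1728`, where Mathlib reads
`v₃(0) = 0`). On the principal-series / cyclic rows of the route (`v₃(Δ_min)` EVEN) this integer is
therefore never `3`. But the tree's kernel analysis of the `9`-torsion at `3` (cell `b2b-bsdres`:
Hauptmodul towers `GaloisImage/WildThreeAdicTower*`, Wuthrich's Lemma 20 PROVED, the semistable-twist
tower) shows that on an X4 pair at `3` (additive, `E[3]` irreducible) with `ρ̄_{E,3}` onto the `3`-adic
tower can only fail at Elkies' value `v₃(j − 1728) = 3`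
(`ClassX4.towerSurj_three_of_surj_of_padicValRat_j_sub_ne`, `Additive/X4ExoticThree.lean`). Hence:

* §1 **`towerSurj_three_of_addv_of_surj_of_even`** — `Addv W 3 → Surj W 3 → Even v₃(Δ_min) →
  ∀ n, ρ̄_{E,3ⁿ}` onto. UNCONDITIONAL (no Elkies moduli sentence, no census, no (ram) witness);
  binder shapes `…_of_classO6_…` (the route's rows), `…_of_subWCyclic_…` (Kraus's cyclic cell),
  and the contrapositive **`odd_padicValInt_minimalDiscriminantInt_of_not_towerSurj_three`**: a
  failing tower with surj(3) at an additive `3` forces `v₃(Δ_min)` ODD — on the wild cell the DICYCLIC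
  Kraus cell, `f₃ ∈ {3, 5}` (`condExp_eq_three_or_five_of_not_towerSurj_three`, via cycu-p4 g2's
  dictionary). This is the structural form of the census TOWER-AT-3-CENSUS-v1 (crux dirs of 21580/21581):
  14 318 / 14 336 `ρ̄₃`-onto classes are tower-onto and the 18 deficient ones all have `v₃(N) = 5`;
  416 / 416 PS classes tower-onto — now theorems `∀ W`.
* §2 **K2**: the registered stub `Cruxes.PSRankOneUpperHalfAtThree.Birth.stub_upperHalf_nonTower` of the
  line `birth` (skeleton `Cruxes/PSRankOneUpperHalfAtThree/Lines/birth.lean`) is PROVED BY NAME with its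
  registered signature — its hypotheses `ClassO6 W 3`, `Surj W 3`, `¬ ∀ n, ρ̄_{E,3ⁿ}` onto, `Even v₃(Δ_min)`
  are contradictory; and `psRankOneUpperHalfAtThree_of_towerStub` — K2 BY NAME from the text of the ONE
  remaining stub `stub_upperHalf_tower` (Kolyvagin–Jetchev with the `3`-adic tower GIVEN).
* §3 **K1**: on the route's rows the case split of line `birth` of K1
  («`(∀ n, ρ̄_{E,3ⁿ} onto) ∧ ¬ 3 ∣ ∏ c_ℓ`») is the Tamagawa condition alone
  (`towerUnit_iff_not_three_dvd_tamagawaProduct`), and `psRankOneLowerHalfAtThree_of_tamagawaSplit` /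
  `…_of_birthStubs` — K1 BY NAME from the text of the landed first lemma `stub_gNineCriterion` (p583210)
  and the two Tamagawa halves (resp. the two registered stubs).

HONEST FRAMING: a lemma about Galois images; it closes a (vacuous) stub of a line and simplifies the
binders of both skeletons; the Kolyvagin / 3-adic Gross–Zagier content of K1/K2 is untouched. BSD is not
advanced by this file. Standard axioms.

References: J.-P. Serre, *Abelian ℓ-adic representations* (1968) IV-23 Lemma 3 [SerreAbelianLadic1968];
N. D. Elkies, arXiv:math/0612734 (2006) §§1, 4 [Elkies2006]; C. Wuthrich, *J. LMS* 2014, Lemma 20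
[Wuthrich2014]; A. Kraus, Manuscripta Math. 69 (1990) [Kraus1990]; J. H. Silverman, *AEC* III.1
(`1728Δ = c₄³ − c₆²`) [SilvermanAEC2009].
-/

noncomputable section

open scoped Classical

open WeierstrassCurve Literature.NumberTheory.EllipticCurves
  Literature.NumberTheory.EllipticCurves.Rank1Residual
  Literature.NumberTheory.EllipticCurves.Rank1Residual.Typed
  Summit.BirchSwinnertonDyer.Rank1Residual.Additive
  Summit.BirchSwinnertonDyer.Rank1Residual.GaloisImage

-- single-conjunct summit: `Summit.BirchSwinnertonDyer.BirchSwinnertonDyer.…` repeats the name by design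
set_option linter.dupNamespace false
set_option autoImplicit false

namespace Summit.BirchSwinnertonDyer.BirchSwinnertonDyer.Theorems.PSTowerOfEven

variable (W : WeierstrassCurve ℚ) [W.IsElliptic]

/-! ### §0 The parity of `v₃(j − 1728)` -/

/-! `j − 1728 = c₆²/Δ` and `v₃(j − 1728) = 2·v₃(c₆) − v₃(Δ)` (`c₆ ≠ 0`) are the tree's
`j_sub_eq_c₆_sq_div_Δ` / `padicValRat_j_sub_eq` (`Additive/SelectorIdentityTameThreeProofs.lean`). -/

omit [W.IsElliptic] in
/-- On a globally minimal model `v₃(Δ) = v₃(Δ_min)` (`Δ = Δ_min` as rational numbers). [folklore] -/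
theorem padicValRat_Δ_eq_padicValInt [W.IsGloballyMinimal] :
    padicValRat 3 W.Δ = (padicValInt 3 W.minimalDiscriminantInt : ℤ) := by
  rw [← cast_minimalDiscriminantInt W, padicValRat.of_int]

/-- **Parity: `v₃(Δ_min)` even ⟹ `v₃(j − 1728) ≠ 3`** (it is `2·v₃(c₆) − v₃(Δ_min)`, even; or `0` at
`c₆ = 0`, i.e. `j = 1728`). [cite: SilvermanAEC2009, III.1 (c₄³ − c₆² = 1728Δ)] -/
theorem padicValRat_j_sub_1728_ne_three_of_even [W.IsGloballyMinimal]
    (hev : Even (padicValInt 3 W.minimalDiscriminantInt)) : padicValRat 3 (W.j - 1728) ≠ 3 := by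
  by_cases hc₆ : W.c₆ = 0
  · rw [j_sub_eq_c₆_sq_div_Δ W, hc₆]
    simp
  · obtain ⟨k, hk⟩ := hev
    rw [padicValRat_j_sub_eq W hc₆, padicValRat_Δ_eq_padicValInt W, hk]
    push_cast
    omega

/-- Conversely **`v₃(j − 1728) = 3` forces `v₃(Δ_min)` odd** (globally minimal model).
[cite: SilvermanAEC2009, III.1 (c₄³ − c₆² = 1728Δ)] -/
theorem odd_padicValInt_of_padicValRat_j_sub_1728_eq_three [W.IsGloballyMinimal]
    (h3 : padicValRat 3 (W.j - 1728) = 3) : Odd (padicValInt 3 W.minimalDiscriminantInt) := by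
  rcases Nat.even_or_odd (padicValInt 3 W.minimalDiscriminantInt) with hev | hodd
  · exact absurd h3 (padicValRat_j_sub_1728_ne_three_of_even W hev)
  · exact hodd

/-! ### §1 The tower on the even rows -/

variable [W.IsGloballyMinimal]

omit [W.IsGloballyMinimal] in
/-- `Addv W 3 ∧ Surj W 3` put the pair in class X4 at `3` (`E[3]` is irreducible because `ρ̄_{E,3}`
is onto, tree theorem `hasIrreducibleModPGaloisRep_of_hasSurjectiveModNGaloisRep`). [folklore] -/
theorem classX4_three_of_addv_of_surj [Fact (Nat.Prime 3)] (hadd : Addv W 3) (hsurj : Surj W 3) :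
    ClassX4 W 3 := by
  haveI : NeZero ((3 : ℕ) : ℚ) := ⟨by norm_num⟩
  exact ⟨by norm_num, hadd, hasIrreducibleModPGaloisRep_of_hasSurjectiveModNGaloisRep W 3 hsurj⟩

/-- **THE `3`-ADIC TOWER ON THE EVEN ROWS, UNCONDITIONALLY.** For a globally minimal `E/ℚ` additive
at `3` with `ρ̄_{E,3}` onto and `v₃(Δ_min)` EVEN, `ρ̄_{E,3ⁿ} : Γ_ℚ → Aut E[3ⁿ]` is onto for every `n`:
`v₃(j − 1728) = 2v₃(c₆) − v₃(Δ_min) ≠ 3` (parity), and off `v₃(j − 1728) = 3` the tree proves the tower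
on X4 at `3` (`ClassX4.towerSurj_three_of_surj_of_padicValRat_j_sub_ne`: Hauptmodul `9`-torsion towers,
Wuthrich's Lemma 20, the semistable-twist tower, `j ≠ 1728` under surj(3)). No Elkies moduli
sentence, no Frobenius certificate, no (ram) witness.
[cite: SerreAbelianLadic1968, Ch. IV §3.4, Lemma 3 (IV-23)] [cite: Wuthrich2014, Lemma 20 (p. 399)]
[cite: Elkies2006, §1 and §4 (the deficient family sits at v₃(j − 1728) = 3, v₃(N) = 5)] -/
theorem towerSurj_three_of_addv_of_surj_of_even (hadd : Addv W 3) (hsurj : Surj W 3)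
    (hev : Even (padicValInt 3 W.minimalDiscriminantInt)) (n : ℕ) :
    W.HasSurjectiveModNGaloisRep (3 ^ n : ℕ) := by
  haveI : Fact (Nat.Prime 3) := ⟨Nat.prime_three⟩
  exact ClassX4.towerSurj_three_of_surj_of_padicValRat_j_sub_ne (classX4_three_of_addv_of_surj W hadd hsurj)
    hsurj (padicValRat_j_sub_1728_ne_three_of_even W hev) n

/-- The same in the route's binder shape (`ClassO6 W 3`: the wild cell at `3`; only "additive" is used).
[cite: SerreAbelianLadic1968, Ch. IV §3.4, Lemma 3 (IV-23)] [cite: Wuthrich2014, Lemma 20 (p. 399)] -/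
theorem towerSurj_three_of_classO6_of_surj_of_even [Fact (Nat.Prime 3)] (hO6 : ClassO6 W 3)
    (hsurj : Surj W 3) (hev : Even (padicValInt 3 W.minimalDiscriminantInt)) (n : ℕ) :
    W.HasSurjectiveModNGaloisRep (3 ^ n : ℕ) :=
  towerSurj_three_of_addv_of_surj_of_even W hO6.2.1 hsurj hev n

/-- The same on Kraus's CYCLIC cell (`SubWCyclic W`: wild with `v₃(Δ_min)` even, `Φ ∈ {C₃, C₆}`):
additive ∧ cyclic ∧ surj(3) ⟹ tower. [cite: Kraus1990, Théorème (p = 3)]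
[cite: SerreAbelianLadic1968, Ch. IV §3.4, Lemma 3 (IV-23)] -/
theorem towerSurj_three_of_subWCyclic_of_surj (hadd : Addv W 3) (hc : SubWCyclic W) (hsurj : Surj W 3)
    (n : ℕ) : W.HasSurjectiveModNGaloisRep (3 ^ n : ℕ) :=
  towerSurj_three_of_addv_of_surj_of_even W hadd hsurj hc.2 n

/-- **Contrapositive: a FAILING tower with surj(3) at an additive `3` forces `v₃(Δ_min)` ODD.**
[cite: SerreAbelianLadic1968, Ch. IV §3.4, Lemma 3 (IV-23)] [cite: Wuthrich2014, Lemma 20 (p. 399)] -/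
theorem odd_padicValInt_minimalDiscriminantInt_of_not_towerSurj_three (hadd : Addv W 3) (hsurj : Surj W 3)
    (hnot : ¬ ∀ n : ℕ, W.HasSurjectiveModNGaloisRep (3 ^ n : ℕ)) :
    Odd (padicValInt 3 W.minimalDiscriminantInt) := by
  rcases Nat.even_or_odd (padicValInt 3 W.minimalDiscriminantInt) with hev | hodd
  · exact absurd (towerSurj_three_of_addv_of_surj_of_even W hadd hsurj hev) hnot
  · exact hodd

/-- On the WILD cell: a failing tower with surj(3) puts the pair in the DICYCLIC Kraus cell
(`SubWDicyclic W`, `Φ ≅ C₃ ⋊ C₄`). [cite: Kraus1990, Théorème (p = 3)] -/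
theorem subWDicyclic_of_not_towerSurj_three (hadd : Addv W 3) (hW : SubW W 3) (hsurj : Surj W 3)
    (hnot : ¬ ∀ n : ℕ, W.HasSurjectiveModNGaloisRep (3 ^ n : ℕ)) : SubWDicyclic W :=
  ⟨hW, odd_padicValInt_minimalDiscriminantInt_of_not_towerSurj_three W hadd hsurj hnot⟩

/-- … hence has conductor exponent `f₃ ∈ {3, 5}` (never `4`): the census reading «the 18 tower-deficient
`ρ̄₃`-onto classes all have `v₃(N) = 5`» as a theorem `∀ W` (cycu-p4 g2's dictionary
`condExp_eq_three_or_five_iff_odd`). [cite: Kraus1990, Théorème (p = 3)] [cite: Elkies2006, §4] -/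
theorem condExp_eq_three_or_five_of_not_towerSurj_three (hadd : Addv W 3) (hW : SubW W 3)
    (hsurj : Surj W 3) (hnot : ¬ ∀ n : ℕ, W.HasSurjectiveModNGaloisRep (3 ^ n : ℕ)) :
    condExp W 3 = 3 ∨
      condExp W 3 = 5 :=
  (PSKodairaDictionary.condExp_eq_three_or_five_iff_odd W hadd hW).2
    (odd_padicValInt_minimalDiscriminantInt_of_not_towerSurj_three W hadd hsurj hnot)

/-- … and never `f₃ = 4`. [cite: Kraus1990, Théorème (p = 3)] -/
theorem condExp_ne_four_of_not_towerSurj_three (hadd : Addv W 3) (hW : SubW W 3) (hsurj : Surj W 3)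
    (hnot : ¬ ∀ n : ℕ, W.HasSurjectiveModNGaloisRep (3 ^ n : ℕ)) :
    condExp W 3 ≠ 4 := by
  rcases condExp_eq_three_or_five_of_not_towerSurj_three W hadd hW hsurj hnot with h | h <;> omega

/-! ### §3 K1: the rung predicate of line `birth` is the Tamagawa condition alone -/

/-- On the route's rows the BC5-rung predicate «`3`-adic tower onto ∧ `3 ∤ ∏ c_ℓ`» of K1's line `birth`
is «`3 ∤ ∏ c_ℓ`» (the tower conjunct is automatic, §1). [cite: SerreAbelianLadic1968, Ch. IV §3.4, Lemma 3 (IV-23)] -/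
theorem towerUnit_iff_not_three_dvd_tamagawaProduct [Fact (Nat.Prime 3)] (hO6 : ClassO6 W 3)
    (hsurj : Surj W 3) (hev : Even (padicValInt 3 W.minimalDiscriminantInt)) :
    ((∀ n : ℕ, W.HasSurjectiveModNGaloisRep (3 ^ n : ℕ)) ∧ ¬ 3 ∣ W.tamagawaProduct) ↔
      ¬ 3 ∣ W.tamagawaProduct :=
  ⟨fun h ↦ h.2, fun h ↦ ⟨towerSurj_three_of_classO6_of_surj_of_even W hO6 hsurj hev, h⟩⟩

end Summit.BirchSwinnertonDyer.BirchSwinnertonDyer.Theorems.PSTowerOfEven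

/-! ### §2 K2: the registered stub `stub_upperHalf_nonTower`, by name (vacuous), and K2 from the tower stub -/

namespace Summit.BirchSwinnertonDyer.BirchSwinnertonDyer.Cruxes.PSRankOneUpperHalfAtThree.Birth

open Summit.BirchSwinnertonDyer.BirchSwinnertonDyer.Theorems

/-- **stub 2 of line `birth` of K2 (`stub_upperHalf_nonTower`), PROVED — VACUOUSLY:** its rows
(`ClassO6 W 3`, `ρ̄_{E,3}` onto, `3`-adic tower NOT onto, `v₃(Δ_min)` even, …) do not exist, by
`PSTowerOfEven.towerSurj_three_of_classO6_of_surj_of_even`. Registered signature verbatim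
(`ledger skeleton check`, crux stmt-BirchSwinnertonDyer-21581, skeleton `Lines/birth.lean`).
[cite: SerreAbelianLadic1968, Ch. IV §3.4, Lemma 3 (IV-23)] [cite: Wuthrich2014, Lemma 20 (p. 399)] -/
theorem stub_upperHalf_nonTower :
    ∀ (W : WeierstrassCurve ℚ) [W.IsElliptic] [W.IsGloballyMinimal],
      ¬ W.HasCM → Summit.BirchSwinnertonDyer.Rank1Residual.Additive.ClassO6 W 3 → Surj W 3 →
      ¬ (∀ n : ℕ, W.HasSurjectiveModNGaloisRep (3 ^ n : ℕ)) →
      Even (padicValInt 3 W.minimalDiscriminantInt) →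
      W.minimalDiscriminantInt / 3 ^ padicValInt 3 W.minimalDiscriminantInt % 3 = 1 →
      W.analyticRank = 1 → Typed.MissingUpperBoundAt W 3 := by
  intro W _ _ _ hO6 hsurj hnt hev _ _
  exact absurd (PSTowerOfEven.towerSurj_three_of_classO6_of_surj_of_even W hO6 hsurj hev) hnt

/-- **K2 BY NAME from the ONE remaining stub.** The route crux `PSRankOneUpperHalfAtThree` follows from
the text of `stub_upperHalf_tower` alone (upper half on the principal-series rows with the `3`-adic
tower GIVEN — Kolyvagin at `3` with Jetchev's sharpening), the non-tower branch being vacuous.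
[cite: Kolyvagin1990, Thm. (structure of Ш via Heegner points)] [cite: Jetchev2008, Thm. 1.4]
[cite: SerreAbelianLadic1968, Ch. IV §3.4, Lemma 3 (IV-23)] -/
theorem psRankOneUpperHalfAtThree_of_towerStub
    (hT : ∀ (W : WeierstrassCurve ℚ) [W.IsElliptic] [W.IsGloballyMinimal],
      ¬ W.HasCM → Summit.BirchSwinnertonDyer.Rank1Residual.Additive.ClassO6 W 3 → Surj W 3 →
      (∀ n : ℕ, W.HasSurjectiveModNGaloisRep (3 ^ n : ℕ)) →
      Even (padicValInt 3 W.minimalDiscriminantInt) →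
      W.minimalDiscriminantInt / 3 ^ padicValInt 3 W.minimalDiscriminantInt % 3 = 1 →
      W.analyticRank = 1 → Typed.MissingUpperBoundAt W 3) :
    Summit.BirchSwinnertonDyer.BirchSwinnertonDyer.Theses.CyclotomicUntwist.PSRankOneUpperHalfAtThree := by
  intro W _ _ hCM hO6 hsurj hev hsq hr
  haveI : Fact (Nat.Prime 3) := ⟨Nat.prime_three⟩
  exact hT W hCM hO6 hsurj (PSTowerOfEven.towerSurj_three_of_classO6_of_surj_of_even W hO6 hsurj hev)
    hev hsq hr

end Summit.BirchSwinnertonDyer.BirchSwinnertonDyer.Cruxes.PSRankOneUpperHalfAtThree.Birth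

/-! ### §3 (continued) K1 BY NAME from the first lemma and the two Tamagawa halves -/

namespace Summit.BirchSwinnertonDyer.BirchSwinnertonDyer.Theorems.PSTowerOfEven

/-- **K1 BY NAME with the tower binder GONE.** `PSRankOneLowerHalfAtThree` follows from the text of the
first lemma (`hG` = the LANDED `Cruxes.PSRankOneLowerHalfAtThree.Birth.stub_gNineCriterion`, p583210 — cited by
text to keep this file out of that module's build cone; PS rows ⊆ (G₉) rows) and the lower half on the two TAMAGAWA halves of the
onto (G₉) rows — «`3 ∤ ∏ c_ℓ`» (the BC5 rung, now without its tower conjunct) and «`3 ∣ ∏ c_ℓ`» — since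
the `3`-adic tower holds on every principal-series row (§1). This is the shape the K1 skeleton's split
takes after this file (a by-name road; the two halves are the crux's content and stay open).
[cite: Kato2004Asterisque, Thm. 12.5 and (12.5.2)] [cite: SerreAbelianLadic1968, Ch. IV §3.4, Lemma 3 (IV-23)] -/
theorem psRankOneLowerHalfAtThree_of_tamagawaSplit
    (hG : ∀ (W : WeierstrassCurve ℚ) [W.IsElliptic] [W.IsGloballyMinimal],
      ClassO6 W 3 → Even (padicValInt 3 W.minimalDiscriminantInt) →
      W.minimalDiscriminantInt / 3 ^ padicValInt 3 W.minimalDiscriminantInt % 3 = 1 → TypeGNine W)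
    (hU : ∀ (W : WeierstrassCurve ℚ) [W.IsElliptic] [W.IsGloballyMinimal],
      ¬ W.HasCM → ClassO6 W 3 → Surj W 3 → TypeGNine W →
      (∀ n : ℕ, W.HasSurjectiveModNGaloisRep (3 ^ n : ℕ)) → ¬ 3 ∣ W.tamagawaProduct →
      W.analyticRank = 1 → Typed.MissingLowerBoundAt W 3)
    (hD : ∀ (W : WeierstrassCurve ℚ) [W.IsElliptic] [W.IsGloballyMinimal],
      ¬ W.HasCM → ClassO6 W 3 → Surj W 3 → TypeGNine W →
      (∀ n : ℕ, W.HasSurjectiveModNGaloisRep (3 ^ n : ℕ)) → 3 ∣ W.tamagawaProduct →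
      W.analyticRank = 1 → Typed.MissingLowerBoundAt W 3) :
    Summit.BirchSwinnertonDyer.BirchSwinnertonDyer.Theses.CyclotomicUntwist.PSRankOneLowerHalfAtThree := by
  intro W _ _ hCM hO6 hsurj hev hsq hr
  haveI : Fact (Nat.Prime 3) := ⟨Nat.prime_three⟩
  have hG9 := hG W hO6 hev hsq
  have hT := towerSurj_three_of_classO6_of_surj_of_even W hO6 hsurj hev
  by_cases h3 : 3 ∣ W.tamagawaProduct
  · exact hD W hCM hO6 hsurj hG9 hT h3 hr
  · exact hU W hCM hO6 hsurj hG9 hT h3 hr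

/-- The registered K1 stubs of line `birth` IMPLY the two Tamagawa halves above with the tower supplied
(`hG` = the landed `stub_gNineCriterion`, by text):
`stub_rung_lowerHalfOnGNine_towerUnit` is literally `hU` with the conjunction bundled, and
`stub_lowerHalfOnGNine_rest` restricted to tower-onto rows is `hD`. So nothing is lost: K1 ⟸ (rung with
`¬ 3 ∣ ∏c`) ∧ (rest with `3 ∣ ∏c`), both on tower-onto rows. [cite: SerreAbelianLadic1968, Ch. IV §3.4, Lemma 3 (IV-23)] -/
theorem psRankOneLowerHalfAtThree_of_birthStubs
    (hG : ∀ (W : WeierstrassCurve ℚ) [W.IsElliptic] [W.IsGloballyMinimal],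
      ClassO6 W 3 → Even (padicValInt 3 W.minimalDiscriminantInt) →
      W.minimalDiscriminantInt / 3 ^ padicValInt 3 W.minimalDiscriminantInt % 3 = 1 → TypeGNine W)
    (hRung : ∀ (W : WeierstrassCurve ℚ) [W.IsElliptic] [W.IsGloballyMinimal],
      ¬ W.HasCM → ClassO6 W 3 → Surj W 3 → TypeGNine W →
      ((∀ n : ℕ, W.HasSurjectiveModNGaloisRep (3 ^ n : ℕ)) ∧ ¬ 3 ∣ W.tamagawaProduct) →
      W.analyticRank = 1 → Typed.MissingLowerBoundAt W 3)
    (hRest : ∀ (W : WeierstrassCurve ℚ) [W.IsElliptic] [W.IsGloballyMinimal],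
      ¬ W.HasCM → ClassO6 W 3 → Surj W 3 → TypeGNine W →
      ¬ ((∀ n : ℕ, W.HasSurjectiveModNGaloisRep (3 ^ n : ℕ)) ∧ ¬ 3 ∣ W.tamagawaProduct) →
      W.analyticRank = 1 → Typed.MissingLowerBoundAt W 3) :
    Summit.BirchSwinnertonDyer.BirchSwinnertonDyer.Theses.CyclotomicUntwist.PSRankOneLowerHalfAtThree :=
  psRankOneLowerHalfAtThree_of_tamagawaSplit hG
    (fun W _ _ hCM hO6 hsurj hG9 hT h3 hr ↦ hRung W hCM hO6 hsurj hG9 ⟨hT, h3⟩ hr)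
    (fun W _ _ hCM hO6 hsurj hG9 _ h3 hr ↦ hRest W hCM hO6 hsurj hG9 (fun h ↦ h.2 h3) hr)

end Summit.BirchSwinnertonDyer.BirchSwinnertonDyer.Theorems.PSTowerOfEven

end
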